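import Literature.Topology.FourManifolds.MTorusCoordinates
import HarnessLib

/-!
# Gluing maps piecewise along a real parameter

Infrastructure for the explicit fishtail neighbourhood (R. Gompf, *More Cappell–Shaneson spheres
are standard*, Algebr. Geom. Topol. 10 (2010), Thm 2.1/Lemma 2.2; the named fact
`Literature.Topology.FourManifolds.gompf2010_framedTwist`). The tube about Gompf's disc is
assembled from a dozen pieces parametrised by a position `r ∈ ℝ` (the first coordinate of the
source `ℝ × P`), consecutive pieces agreeing on open slabs around the breakpoints. This file
provides the two-piece combinator and its calculus:

* `Literature.Topology.FourManifolds.glue2 s f g q = if q.1 < s then f q else g q`;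
* germs: `glue2 = f` near points with `q.1 < s`, `= g` near points with `s < q.1`, and `= g`
  (and `= f`) near points of an agreement slab `|q.1 - s| < δ` on which `f = g`
  (`glue2_eventuallyEq_left/right/of_agree`); hence transfer of `ContMDiffAt` and
  `IsLocalDiffeomorphAt` (`contMDiffAt_glue2`, `isLocalDiffeomorphAt_glue2`);
* injectivity from injectivity of the pieces, agreement on the slab, and separation of the far
  parts (`injOn_glue2`).

Everything is proved; no named facts.
-/

noncomputable section

open scoped Topology Manifold ContDiff
open Set Function Filter

namespace Literature.Topology.FourManifolds

section Glue2

variable {P : Type*} {N : Type*} (s : ℝ) (f g : ℝ × P → N)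

/-- **The two-piece combinator** along the first coordinate. [folklore] -/
def glue2 (q : ℝ × P) : N := by
  classical
  exact if q.1 < s then f q else g q

variable {s f g}

/-- Left of the breakpoint the glued map is `f`. [folklore] -/
theorem glue2_of_lt {q : ℝ × P} (h : q.1 < s) : glue2 s f g q = f q := by rw [glue2, if_pos h]

/-- Right of the breakpoint the glued map is `g`. [folklore] -/
theorem glue2_of_le {q : ℝ × P} (h : s ≤ q.1) : glue2 s f g q = g q := by rw [glue2, if_neg (not_lt.2 h)]

/-- On an agreement slab the glued map is `g` (and `f`). [folklore] -/
theorem glue2_of_agree {δ : ℝ} (hfg : ∀ q : ℝ × P, |q.1 - s| < δ → f q = g q) {q : ℝ × P} (h : |q.1 - s| < δ) :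
    glue2 s f g q = g q := by
  rcases lt_or_ge q.1 s with hl | hr
  · rw [glue2_of_lt hl, hfg q h]
  · exact glue2_of_le hr

variable [TopologicalSpace P]

/-- Germ left of the breakpoint. [folklore] -/
theorem glue2_eventuallyEq_left {q : ℝ × P} (h : q.1 < s) : glue2 s f g =ᶠ[𝓝 q] f := by
  have ho : IsOpen {q : ℝ × P | q.1 < s} := isOpen_lt continuous_fst continuous_const
  exact eventuallyEq_of_mem (ho.mem_nhds h) fun q' hq' ↦ glue2_of_lt hq'

/-- Germ right of the breakpoint. [folklore] -/
theorem glue2_eventuallyEq_right {q : ℝ × P} (h : s < q.1) : glue2 s f g =ᶠ[𝓝 q] g := by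
  have ho : IsOpen {q : ℝ × P | s < q.1} := isOpen_lt continuous_const continuous_fst
  exact eventuallyEq_of_mem (ho.mem_nhds h) fun q' hq' ↦ glue2_of_le (le_of_lt hq')

/-- Germ on the agreement slab. [folklore] -/
theorem glue2_eventuallyEq_of_agree {δ : ℝ} (hfg : ∀ q : ℝ × P, |q.1 - s| < δ → f q = g q) {q : ℝ × P}
    (h : |q.1 - s| < δ) : glue2 s f g =ᶠ[𝓝 q] g := by
  have ho : IsOpen {q : ℝ × P | |q.1 - s| < δ} :=
    isOpen_lt (continuous_abs.comp (continuous_fst.sub continuous_const)) continuous_const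
  exact eventuallyEq_of_mem (ho.mem_nhds h) fun q' hq' ↦ glue2_of_agree hfg hq'

/-- **The glued map is locally one of the pieces** at every point, given an agreement slab of
positive width. [folklore] -/
theorem glue2_eventuallyEq {δ : ℝ} (hδ : 0 < δ) (hfg : ∀ q : ℝ × P, |q.1 - s| < δ → f q = g q) (q : ℝ × P) :
    (q.1 < s ∧ glue2 s f g =ᶠ[𝓝 q] f) ∨ (s - δ < q.1 ∧ glue2 s f g =ᶠ[𝓝 q] g) := by
  rcases lt_or_ge q.1 (s - δ / 2) with hl | hr
  · exact Or.inl ⟨by linarith, glue2_eventuallyEq_left (by linarith)⟩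
  · right
    refine ⟨by linarith, ?_⟩
    rcases lt_or_ge q.1 (s + δ / 2) with hm | hbig
    · exact glue2_eventuallyEq_of_agree hfg (abs_lt.2 ⟨by linarith, by linarith⟩)
    · exact glue2_eventuallyEq_right (by linarith)

end Glue2

section Smooth

variable {E H : Type*} [NormedAddCommGroup E] [NormedSpace ℝ E] [TopologicalSpace H] {I : ModelWithCorners ℝ E H}
  {N : Type*} [TopologicalSpace N] [ChartedSpace H N]
  {F : Type*} [NormedAddCommGroup F] [NormedSpace ℝ F]
  {s : ℝ} {f g : ℝ × F → N}

/-- **Smoothness of the glued map** at a point from smoothness of the relevant piece. [folklore] -/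
theorem contMDiffAt_glue2 {δ : ℝ} (hδ : 0 < δ) (hfg : ∀ q : ℝ × F, |q.1 - s| < δ → f q = g q) {q : ℝ × F}
    (hf : q.1 < s → ContMDiffAt 𝓘(ℝ, ℝ × F) I ∞ f q) (hg : s - δ < q.1 → ContMDiffAt 𝓘(ℝ, ℝ × F) I ∞ g q) :
    ContMDiffAt 𝓘(ℝ, ℝ × F) I ∞ (glue2 s f g) q := by
  rcases glue2_eventuallyEq hδ hfg q with ⟨h1, h2⟩ | ⟨h1, h2⟩
  · exact (hf h1).congr_of_eventuallyEq h2
  · exact (hg h1).congr_of_eventuallyEq h2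

/-- **The glued map is a local diffeomorphism** at a point where the relevant piece is. [folklore] -/
theorem isLocalDiffeomorphAt_glue2 {δ : ℝ} (hδ : 0 < δ) (hfg : ∀ q : ℝ × F, |q.1 - s| < δ → f q = g q) {q : ℝ × F}
    (hf : q.1 < s → IsLocalDiffeomorphAt 𝓘(ℝ, ℝ × F) I ∞ f q)
    (hg : s - δ < q.1 → IsLocalDiffeomorphAt 𝓘(ℝ, ℝ × F) I ∞ g q) :
    IsLocalDiffeomorphAt 𝓘(ℝ, ℝ × F) I ∞ (glue2 s f g) q := by
  rcases glue2_eventuallyEq hδ hfg q with ⟨h1, h2⟩ | ⟨h1, h2⟩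
  · exact isLocalDiffeomorphAt_congr_nhds' (hf h1) h2
  · exact isLocalDiffeomorphAt_congr_nhds' (hg h1) h2

end Smooth

section Inj

variable {P : Type*} {N : Type*} {s : ℝ} {f g : ℝ × P → N}

/-- **Injectivity of the glued map** on a set `S`: from injectivity of `f` on `S ∩ {r < s + δ}`,
of `g` on `S ∩ {s ≤ r}`, agreement on the slab `|r - s| < δ`, and separation of
`f (S ∩ {r < s})` from `g (S ∩ {s + δ ≤ r})`. [folklore] -/
theorem injOn_glue2 {S : Set (ℝ × P)} {δ : ℝ} (hδ : 0 < δ) (hfg : ∀ q : ℝ × P, |q.1 - s| < δ → f q = g q)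
    (hf : InjOn f (S ∩ {q | q.1 < s + δ})) (hg : InjOn g (S ∩ {q | s ≤ q.1}))
    (hsep : ∀ q ∈ S, ∀ q' ∈ S, q.1 < s → s + δ ≤ q'.1 → f q ≠ g q') :
    InjOn (glue2 s f g) S := by
  -- ordered key statement
  have key : ∀ q ∈ S, ∀ q' ∈ S, q.1 ≤ q'.1 → glue2 s f g q = glue2 s f g q' → q = q' := by
    intro q hq q' hq' hle heq
    rcases lt_or_ge q'.1 s with h' | h'
    · -- both left
      rw [glue2_of_lt (lt_of_le_of_lt hle h'), glue2_of_lt h'] at heq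
      exact hf ⟨hq, by show q.1 < s + δ; linarith⟩ ⟨hq', by show q'.1 < s + δ; linarith⟩ heq
    · rcases lt_or_ge q.1 s with h | h
      · -- `q` left, `q'` right
        rw [glue2_of_lt h, glue2_of_le h'] at heq
        rcases lt_or_ge q'.1 (s + δ) with h1 | h1
        · -- `q'` in the slab: `g q' = f q'`
          rw [← hfg q' (abs_lt.2 ⟨by linarith, by linarith⟩)] at heq
          exact hf ⟨hq, by show q.1 < s + δ; linarith⟩ ⟨hq', h1⟩ heq
        · exact absurd heq (hsep q hq q' hq' h h1)
      · -- both right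
        rw [glue2_of_le h, glue2_of_le h'] at heq
        exact hg ⟨hq, h⟩ ⟨hq', h'⟩ heq
  intro q hq q' hq' heq
  rcases le_total q.1 q'.1 with h | h
  · exact key q hq q' hq' h heq
  · exact (key q' hq' q hq h heq.symm).symm

end Inj

end Literature.Topology.FourManifolds
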